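import Summits.Schanuel.Schanuel.Theorems.RootDecomp1BFedFlagDefs
import Literature.ModelTheory.ExponentialFields.ExponentialField
import Literature.NumberTheory.Transcendental.LindemannWeierstrassProofs
import Literature.NumberTheory.Transcendental.SchanuelEclEmptyProofs
import Literature.NumberTheory.Transcendental.OneMotiveToric

/-!
# RootDecomp1BFedFlagCore — the LENGTH REDUCTION of lens 4 gen 7 (node «PolarFlag»), route-independent kernel

`fedKleinPolar_of_flag_steps : FedSharpStep → FedSurplusOneStep → FedKleinPolar` and its exactness `fedKleinPolar_iff_flag_steps`: the two
ONE-STEP FLAG statements imply Klein-polar Schanuel at every FED real tuple under the induction hypothesis (re-base the fed direction to the last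
coordinate by `exists_rebase`, flag tower law, relative degree ≤ 2, first-failure normalisation).  The definitions live in
`RootDecomp1BFedFlagDefs`; the transfer to the live route item `BaseFedCoupling` (stmt-Schanuel-30165) is `RootDecomp1BFedFlag`.
Port (census seat, prover role) of `HOME/decomp-schanuel-lens-4/g7/prover/RootDecomp1BFedFlagCore.port.lean` (critic-CLEARED node PolarFlag, round 7
of RootDecomp1B); dedup twins of landed toolkit one-liners replaced by `OneMotiveToric.trdeg_mono` / restated non-verbatim; defines nothing; 0 sorry.
-/

open Complex IntermediateField
open Literature.NumberTheory.Transcendental (trdeg_adjoin_le_of_le isAlgebraic_adjoin_over_algebraAdjoin)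
open Literature.NumberTheory.Transcendental.OneMotiveToric (trdeg_mono)

namespace Summit.Schanuel.Schanuel.Theorems.RootDecomp1BFedFlagCore

set_option linter.dupNamespace false

/-- If the tuple `f` takes values among those of `g`, the Schanuel generators of `f` are among those of `g`. -/
theorem gens_mono {ι κ : Type*} {f : ι → ℂ} {g : κ → ℂ} (h : Set.range f ⊆ Set.range g) :
    Set.range f ∪ Set.range (Complex.exp ∘ f) ⊆ Set.range g ∪ Set.range (Complex.exp ∘ g) := by
  refine Set.union_subset_union h ?_
  rw [Set.range_comp, Set.range_comp]
  exact Set.image_mono h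

/-- The polar tuple of the initial hyperplane `r ∘ Fin.castSucc` sits inside the polar tuple of `r`. -/
theorem range_polar_init_subset {m : ℕ} (r : Fin (m + 1) → ℝ) :
    Set.range (Fin.append (fun j : Fin m => ((r (Fin.castSucc j) : ℝ) : ℂ))
        (fun j : Fin m => ((r (Fin.castSucc j) : ℝ) : ℂ) * Complex.I)) ⊆
      Set.range (Fin.append (fun j => ((r j : ℝ) : ℂ)) (fun j => ((r j : ℝ) : ℂ) * Complex.I)) := by
  rintro _ ⟨k, rfl⟩
  induction k using Fin.addCases with
  | left j => exact ⟨Fin.castAdd (m + 1) (Fin.castSucc j), by simp only [Fin.append_left]⟩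
  | right j => exact ⟨Fin.natAdd (m + 1) (Fin.castSucc j), by simp only [Fin.append_right]⟩

/-- A field generated by a FINITE set has finite transcendence degree. [folklore] -/
theorem trdeg_adjoin_lt_aleph0_of_finite {F E : Type*} [Field F] [Field E] [Algebra F E] {S : Set E} (hS : S.Finite) :
    Algebra.trdeg F ↥(IntermediateField.adjoin F S) < Cardinal.aleph0 := by
  haveI := isAlgebraic_adjoin_over_algebraAdjoin (F := F) S
  exact ((Algebra.IsAlgebraic.trdeg_le_cardinalMk F
      (((↑) : ↥(IntermediateField.adjoin F S) → E) ⁻¹' S) (A := ↥(IntermediateField.adjoin F S))).trans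
    (Cardinal.mk_preimage_of_injective _ _ Subtype.val_injective)).trans_lt hS.lt_aleph0

/-- A finitely generated subfield of `ℂ` has finite transcendence degree. -/
theorem trdeg_adjoin_lt_aleph0 {S : Set ℂ} (hS : S.Finite) :
    Algebra.trdeg ℚ ↥(adjoin ℚ S) < Cardinal.aleph0 :=
  trdeg_adjoin_lt_aleph0_of_finite (F := ℚ) hS

/-- The polar transcendence degree `t(r)` of a finite real tuple is finite. -/
theorem polarDeg_lt_aleph0 {m : ℕ} (r : Fin m → ℝ) : polarDeg r < Cardinal.aleph0 :=
  trdeg_adjoin_lt_aleph0 ((Set.finite_range _).union (Set.finite_range _))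

/-- Each coordinate lies in the ℚ-span of the tuple. -/
theorem coord_mem_span {m : ℕ} (r : Fin m → ℝ) (j : Fin m) : r j ∈ Submodule.span ℚ (Set.range r) :=
  Submodule.subset_span ⟨j, rfl⟩

/-- A coordinate direction with `e^{r_{j₀}}` algebraic over `ℚ(r)` feeds the tuple. -/
theorem isFed_of_isAlgebraic_base_exp_coord {m : ℕ} (r : Fin m → ℝ) (j₀ : Fin m) (h0 : r j₀ ≠ 0)
    (halg : IsAlgebraic ↥(baseField r) (Complex.exp ((r j₀ : ℝ) : ℂ))) : IsFed m r :=
  ⟨r j₀, coord_mem_span r j₀, h0, Or.inl halg⟩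

/-- A coordinate direction with `e^{i r_{j₀}}` algebraic over `ℚ(r)` feeds the tuple. -/
theorem isFed_of_isAlgebraic_base_exp_coord_mul_I {m : ℕ} (r : Fin m → ℝ) (j₀ : Fin m) (h0 : r j₀ ≠ 0)
    (halg : IsAlgebraic ↥(baseField r) (Complex.exp (((r j₀ : ℝ) : ℂ) * Complex.I))) : IsFed m r :=
  ⟨r j₀, coord_mem_span r j₀, h0, Or.inr halg⟩

/-- Algebraicity over a subfield passes to every larger subfield (argument order: the algebraicity first). -/
theorem isAlgebraic_up {K L : IntermediateField ℚ ℂ} {x : ℂ} (h : IsAlgebraic (↥K) x) (hKL : K ≤ L) :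
    IsAlgebraic (↥L) x := by
  obtain ⟨p, hp0, hpx⟩ := h
  have hinj : Function.Injective (IntermediateField.inclusion hKL).toRingHom :=
    (IntermediateField.inclusion hKL).toRingHom.injective
  refine ⟨p.map (IntermediateField.inclusion hKL).toRingHom, ?_, ?_⟩
  · exact (Polynomial.map_ne_zero_iff hinj).mpr hp0
  · have hc : (algebraMap (↥L) ℂ).comp (IntermediateField.inclusion hKL).toRingHom = algebraMap (↥K) ℂ :=
      RingHom.ext fun y => rfl
    rw [Polynomial.aeval_def, Polynomial.eval₂_map, hc, ← Polynomial.aeval_def, hpx]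

section Gen7

variable {m : ℕ}

/-- The polar field is the field generated by the polar generators (`rfl`). -/
theorem polarField_eq_adjoin (r : Fin m → ℝ) : polarField r = IntermediateField.adjoin ℚ (polarGens r) := rfl

/-- The initial hyperplane of a ℚ-free tuple is ℚ-free. -/
theorem linearIndependent_init {r : Fin (m + 1) → ℝ} (hr : LinearIndependent ℚ r) :
    LinearIndependent ℚ (Fin.init r) :=
  hr.comp Fin.castSucc (Fin.castSucc_injective m)

/-- Under `KleinIH (m+1)` the hyperplane satisfies X: `2m ≤ t(r')`, i.e. its surplus `s' ≥ 0`. -/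
theorem two_mul_le_polarDeg_init {r : Fin (m + 1) → ℝ} (hr : LinearIndependent ℚ r) (hIH : KleinIH (m + 1)) :
    ((m + m : ℕ) : Cardinal) ≤ polarDeg (Fin.init r) :=
  hIH m (Nat.lt_succ_self m) (Fin.init r) (linearIndependent_init hr)

/-- Monotonicity along the flag: `t(r') ≤ t(r)`. -/
theorem polarDeg_init_le (r : Fin (m + 1) → ℝ) : polarDeg (Fin.init r) ≤ polarDeg r :=
  trdeg_mono (IntermediateField.adjoin.mono ℚ _ _ (gens_mono (range_polar_init_subset r)))

/-- The two flag steps give Klein-polar Schanuel at a tuple whose LAST coordinate is fed (case split on the surplus of the initial hyperplane: sharp, surplus one, or ≥ 2 by monotonicity). -/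
theorem kleinPolar_of_lastFed (hS : FedSharpStep) (h1 : FedSurplusOneStep) {r : Fin (m + 1) → ℝ}
    (hr : LinearIndependent ℚ r) (hIH : KleinIH (m + 1)) (hfed : LastFed m r) :
    ((m + 1 + (m + 1) : ℕ) : Cardinal) ≤ polarDeg r := by
  have hlow := two_mul_le_polarDeg_init hr hIH
  have hmono := polarDeg_init_le r
  obtain ⟨n', hn'⟩ := Cardinal.lt_aleph0.mp (polarDeg_lt_aleph0 (Fin.init r))
  rw [hn'] at hlow hmono
  have hlow' : m + m ≤ n' := by exact_mod_cast hlow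
  rcases Nat.lt_or_ge n' (m + m + 2) with hlt | hge
  · rcases Nat.lt_or_ge n' (m + m + 1) with hlt1 | hge1
    · have h4 : polarDeg (Fin.init r) ≤ ((m + m : ℕ) : Cardinal) := by
        rw [hn']
        exact_mod_cast (by omega : n' ≤ m + m)
      exact hS m r hr hIH hfed h4
    · have h4 : polarDeg (Fin.init r) = ((m + m + 1 : ℕ) : Cardinal) := by
        rw [hn']
        exact_mod_cast (by omega : n' = m + m + 1)
      exact h1 m r hr hIH hfed h4
  · calc ((m + 1 + (m + 1) : ℕ) : Cardinal) ≤ (n' : Cardinal) := by exact_mod_cast (by omega : m + 1 + (m + 1) ≤ n')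
      _ ≤ polarDeg r := hmono

/-- Clearing denominators: a rational vector is an integer vector divided by a common positive integer. -/
theorem exists_int_clear (c : Fin (m + 1) → ℚ) :
    ∃ (N : ℕ) (n : Fin (m + 1) → ℤ), 0 < N ∧ ∀ j, (N : ℚ) * c j = (n j : ℚ) := by
  classical
  refine ⟨∏ j, (c j).den, fun j => (∏ k ∈ Finset.univ.erase j, ((c k).den : ℤ)) * (c j).num,
    Finset.prod_pos fun j _ => (c j).den_pos, fun j => ?_⟩
  rw [← Finset.prod_erase_mul Finset.univ (fun k => (c k).den) (Finset.mem_univ j)]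
  push_cast
  rw [mul_assoc, mul_comm ((c j).den : ℚ) (c j), Rat.mul_den_eq_num]

/-- Real coordinates of `span_ℚ`-elements lie in the generated subfield of `ℂ`. -/
theorem coe_mem_adjoin_of_mem_span {k : ℕ} (w : Fin k → ℝ) {v : ℝ} (hv : v ∈ Submodule.span ℚ (Set.range w)) :
    ((v : ℝ) : ℂ) ∈ IntermediateField.adjoin ℚ (Set.range (fun j => ((w j : ℝ) : ℂ))) := by
  induction hv using Submodule.span_induction with
  | mem x hx =>
    obtain ⟨j, rfl⟩ := hx
    exact subset_adjoin ℚ _ ⟨j, rfl⟩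
  | zero => simp
  | add x y _ _ hx hy => rw [Complex.ofReal_add]; exact add_mem hx hy
  | smul q x _ hx =>
    rw [Rat.smul_def, Complex.ofReal_mul, Complex.ofReal_ratCast]
    have hq := (IntermediateField.adjoin ℚ (Set.range (fun j => ((w j : ℝ) : ℂ)))).algebraMap_mem q
    rw [eq_ratCast] at hq
    exact mul_mem hq hx

/-- RE-BASING LEMMA.  A nonzero `v ∈ span_ℚ(r)` can be made — up to a positive integer multiple `N v = ∑ n_j r_j`,
`n_j ∈ ℤ` — the LAST coordinate of a `ℚ`-free tuple `w` whose other coordinates are coordinates of `r` and whose span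
contains every `r_k` (so `B(r) ≤ B(w)` and `F(w) ≤ F(r)`). -/
theorem exists_rebase {r : Fin (m + 1) → ℝ} (hr : LinearIndependent ℚ r) {v : ℝ}
    (hv : v ∈ Submodule.span ℚ (Set.range r)) (hv0 : v ≠ 0) :
    ∃ (w : Fin (m + 1) → ℝ) (N : ℕ) (n : Fin (m + 1) → ℤ), 0 < N ∧ LinearIndependent ℚ w ∧
      w (Fin.last m) = (N : ℝ) * v ∧ (N : ℝ) * v = ∑ j, (n j : ℝ) * r j ∧
      (∀ j : Fin m, ∃ k, w (Fin.castSucc j) = r k) ∧ (∀ j, w j ∈ Submodule.span ℚ (Set.range r)) ∧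
      (∀ k, r k ∈ Submodule.span ℚ (Set.range w)) := by
  classical
  obtain ⟨c, hc⟩ := (Submodule.mem_span_range_iff_exists_fun ℚ).1 hv
  have hj : ∃ j₀, c j₀ ≠ 0 := by
    by_contra h
    push Not at h
    apply hv0
    rw [← hc]
    exact Finset.sum_eq_zero fun j _ => by rw [h j, zero_smul]
  obtain ⟨j₀, hj₀⟩ := hj
  obtain ⟨N, n, hN, hn⟩ := exists_int_clear c
  have hNv : (N : ℝ) * v = ∑ j, (n j : ℝ) * r j := by
    rw [← hc, Finset.mul_sum]
    refine Finset.sum_congr rfl fun j _ => ?_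
    rw [Rat.smul_def, ← mul_assoc]
    congr 1
    have h' := congrArg (fun q : ℚ => (q : ℝ)) (hn j)
    push_cast at h'
    exact h'
  set σ : Equiv.Perm (Fin (m + 1)) := Equiv.swap j₀ (Fin.last m) with hσ
  set w : Fin (m + 1) → ℝ := fun j => if j = Fin.last m then (N : ℝ) * v else r (σ j) with hw_def
  have hw_last : w (Fin.last m) = (N : ℝ) * v := if_pos rfl
  have hw_ne : ∀ j, j ≠ Fin.last m → w j = r (σ j) := fun j hj => if_neg hj
  have hw_span : ∀ j, w j ∈ Submodule.span ℚ (Set.range r) := by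
    intro j
    by_cases hj : j = Fin.last m
    · rw [hj, hw_last, show (N : ℝ) * v = (N : ℚ) • v by rw [Rat.smul_def, Rat.cast_natCast]]
      exact Submodule.smul_mem _ _ hv
    · rw [hw_ne j hj]
      exact Submodule.subset_span ⟨σ j, rfl⟩
  have hr_span_ne : ∀ k, k ≠ j₀ → r k ∈ Submodule.span ℚ (Set.range w) := by
    intro k hk
    have hσk : σ k ≠ Fin.last m := by
      intro h
      apply hk
      have := congrArg σ.symm h
      rw [Equiv.symm_apply_apply] at this
      rw [this, hσ, Equiv.symm_swap, Equiv.swap_apply_right]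
    have : w (σ k) = r k := by
      rw [hw_ne _ hσk, hσ, Equiv.swap_apply_self]
    rw [← this]
    exact Submodule.subset_span ⟨σ k, rfl⟩
  have hr_span : ∀ k, r k ∈ Submodule.span ℚ (Set.range w) := by
    intro k
    by_cases hk : k = j₀
    · rw [hk]
      have hnj : (n j₀ : ℝ) ≠ 0 := by
        have : (n j₀ : ℚ) ≠ 0 := by
          rw [← hn j₀]
          exact mul_ne_zero (by exact_mod_cast hN.ne') hj₀
        exact_mod_cast this
      have hsplit : (n j₀ : ℝ) * r j₀ = (N : ℝ) * v - ∑ j ∈ Finset.univ.erase j₀, (n j : ℝ) * r j := by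
        rw [hNv, ← Finset.add_sum_erase Finset.univ (fun j => (n j : ℝ) * r j) (Finset.mem_univ j₀)]
        ring
      have hmem : (N : ℝ) * v - ∑ j ∈ Finset.univ.erase j₀, (n j : ℝ) * r j ∈ Submodule.span ℚ (Set.range w) := by
        refine Submodule.sub_mem _ ?_ (Submodule.sum_mem _ fun j hj => ?_)
        · rw [← hw_last]
          exact Submodule.subset_span ⟨Fin.last m, rfl⟩
        · rw [show (n j : ℝ) * r j = (n j : ℚ) • r j by rw [Rat.smul_def, Rat.cast_intCast]]
          exact Submodule.smul_mem _ _ (hr_span_ne j (Finset.ne_of_mem_erase hj))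
      have : r j₀ = (n j₀ : ℚ)⁻¹ • ((n j₀ : ℝ) * r j₀) := by
        rw [Rat.smul_def, Rat.cast_inv, Rat.cast_intCast, ← mul_assoc, inv_mul_cancel₀ hnj, one_mul]
      rw [this, hsplit]
      exact Submodule.smul_mem _ _ hmem
    · exact hr_span_ne k hk
  have hspan : Submodule.span ℚ (Set.range w) = Submodule.span ℚ (Set.range r) := by
    refine Submodule.span_eq_span ?_ ?_
    · rintro _ ⟨j, rfl⟩
      exact hw_span j
    · rintro _ ⟨k, rfl⟩
      exact hr_span k
  have hw : LinearIndependent ℚ w := by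
    rw [linearIndependent_iff_card_eq_finrank_span] at hr ⊢
    rw [hr]
    show Set.finrank ℚ (Set.range r) = Set.finrank ℚ (Set.range w)
    unfold Set.finrank
    rw [hspan]
  refine ⟨w, N, n, hN, hw, hw_last, hNv, fun j => ?_, hw_span, hr_span⟩
  exact ⟨σ (Fin.castSucc j), hw_ne _ (Fin.castSucc_lt_last j).ne⟩

/-- The coordinates `r_j` lie in the polar field. -/
theorem coe_mem_polarField {k : ℕ} (r : Fin k → ℝ) (j : Fin k) : ((r j : ℝ) : ℂ) ∈ polarField r :=
  subset_adjoin ℚ _ (Or.inl ⟨Fin.castAdd k j, by simp only [Fin.append_left]⟩)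

/-- The coordinates `i r_j` lie in the polar field. -/
theorem coe_mul_I_mem_polarField {k : ℕ} (r : Fin k → ℝ) (j : Fin k) :
    ((r j : ℝ) : ℂ) * Complex.I ∈ polarField r :=
  subset_adjoin ℚ _ (Or.inl ⟨Fin.natAdd k j, by simp only [Fin.append_right]⟩)

/-- The exponentials `e^{r_j}` lie in the polar field. -/
theorem exp_coe_mem_polarField {k : ℕ} (r : Fin k → ℝ) (j : Fin k) :
    Complex.exp ((r j : ℝ) : ℂ) ∈ polarField r :=
  subset_adjoin ℚ _ (Or.inr ⟨Fin.castAdd k j, by simp only [Function.comp_apply, Fin.append_left]⟩)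

/-- The exponentials `e^{i r_j}` lie in the polar field. -/
theorem exp_coe_mul_I_mem_polarField {k : ℕ} (r : Fin k → ℝ) (j : Fin k) :
    Complex.exp (((r j : ℝ) : ℂ) * Complex.I) ∈ polarField r :=
  subset_adjoin ℚ _ (Or.inr ⟨Fin.natAdd k j, by simp only [Function.comp_apply, Fin.append_right]⟩)

/-- exponentials of INTEGER combinations of the coordinates lie in the polar field. -/
theorem exp_intComb_mem_polarField {k : ℕ} (r : Fin k → ℝ) (n : Fin k → ℤ) :
    Complex.exp (((∑ j, (n j : ℝ) * r j : ℝ) : ℂ)) ∈ polarField r ∧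
      Complex.exp ((((∑ j, (n j : ℝ) * r j : ℝ) : ℂ)) * Complex.I) ∈ polarField r := by
  have h1 : (((∑ j, (n j : ℝ) * r j : ℝ) : ℂ)) = ∑ j, ((n j : ℤ) : ℂ) * ((r j : ℝ) : ℂ) := by
    simp only [Complex.ofReal_sum, Complex.ofReal_mul, Complex.ofReal_intCast]
  constructor
  · rw [h1, Complex.exp_sum]
    refine IntermediateField.prod_mem _ fun j _ => ?_
    rw [Complex.exp_int_mul]
    exact zpow_mem (exp_coe_mem_polarField r j) _
  · rw [h1, Finset.sum_mul, Complex.exp_sum]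
    refine IntermediateField.prod_mem _ fun j _ => ?_
    rw [mul_assoc, Complex.exp_int_mul]
    exact zpow_mem (exp_coe_mul_I_mem_polarField r j) _

/-- `i ∈ F(r)` as soon as `r` has a nonzero coordinate. -/
theorem I_mem_polarField {k : ℕ} (r : Fin k → ℝ) (j : Fin k) (h0 : r j ≠ 0) : Complex.I ∈ polarField r := by
  have h0' : ((r j : ℝ) : ℂ) ≠ 0 := by exact_mod_cast h0
  have : Complex.I = (((r j : ℝ) : ℂ))⁻¹ * (((r j : ℝ) : ℂ) * Complex.I) := by
    rw [← mul_assoc, inv_mul_cancel₀ h0', one_mul]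
  rw [this]
  exact mul_mem (inv_mem (coe_mem_polarField r j)) (coe_mul_I_mem_polarField r j)

/-- base field ≤ polar field -/
theorem baseField_le_polarField {k : ℕ} (r : Fin k → ℝ) : baseField r ≤ polarField r := by
  change IntermediateField.adjoin ℚ _ ≤ _
  rw [adjoin_le_iff]
  rintro _ ⟨j, rfl⟩
  exact coe_mem_polarField r j

/-- A fed tuple has positive length. -/
theorem pos_of_isFed {k : ℕ} {r : Fin k → ℝ} (h : IsFed k r) : 0 < k := by
  rcases Nat.eq_zero_or_pos k with hk | hk
  · subst hk
    obtain ⟨v, hv, hv0, -⟩ := h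
    rw [Set.range_eq_empty, Submodule.span_empty, Submodule.mem_bot] at hv
    exact absurd hv hv0
  · exact hk

/-- THE LENGTH REDUCTION (kernel of the ledger glue): FSH ∧ FS1 ⟹ X at every FED tuple, under `KleinIH`.  Proof:
re-base so that the fed direction is the last coordinate (`exists_rebase`: `F(w) ≤ F(r)`, `B(r) ≤ B(w)`, `(e^v)^N` stays
algebraic), then the flag trichotomy `kleinPolar_of_lastFed`. -/
theorem fedKleinPolar_of_flag_steps (hS : FedSharpStep) (h1 : FedSurplusOneStep) : FedKleinPolar := by
  intro m₀ r hr hIH hfed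
  obtain ⟨m, rfl⟩ : ∃ m, m₀ = m + 1 := ⟨m₀ - 1, (Nat.succ_pred_eq_of_pos (pos_of_isFed hfed)).symm⟩
  obtain ⟨v, hv, hv0, halg⟩ := hfed
  obtain ⟨w, N, n, hN, hw, hw_last, hNv, hw_init, hw_span, hr_span⟩ := exists_rebase hr hv hv0
  -- (a) the polar field of `w` sits inside that of `r`
  have hI : Complex.I ∈ polarField r := I_mem_polarField r 0 (hr.ne_zero 0)
  have hwC : ∀ j, ((w j : ℝ) : ℂ) ∈ polarField r := fun j =>
    baseField_le_polarField r (coe_mem_adjoin_of_mem_span r (hw_span j))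
  have hF : polarField w ≤ polarField r := by
    rw [polarField_eq_adjoin, adjoin_le_iff]
    rintro x (⟨i, rfl⟩ | ⟨i, rfl⟩)
    · induction i using Fin.addCases with
      | left j => simp only [Fin.append_left]; exact hwC j
      | right j => simp only [Fin.append_right]; exact mul_mem (hwC j) hI
    · induction i using Fin.addCases with
      | left j =>
        simp only [Function.comp_apply, Fin.append_left]
        rcases Fin.eq_castSucc_or_eq_last j with ⟨j', rfl⟩ | rfl
        · obtain ⟨k, hk⟩ := hw_init j'
          rw [hk]
          exact exp_coe_mem_polarField r k
        · rw [hw_last, hNv]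
          exact (exp_intComb_mem_polarField r n).1
      | right j =>
        simp only [Function.comp_apply, Fin.append_right]
        rcases Fin.eq_castSucc_or_eq_last j with ⟨j', rfl⟩ | rfl
        · obtain ⟨k, hk⟩ := hw_init j'
          rw [hk]
          exact exp_coe_mul_I_mem_polarField r k
        · rw [hw_last, hNv]
          exact (exp_intComb_mem_polarField r n).2
  have ht : polarDeg w ≤ polarDeg r := trdeg_mono hF
  -- (b) the base field of `r` sits inside that of `w`, so the last coordinate of `w` is fed
  have hB : baseField r ≤ baseField w := by
    change IntermediateField.adjoin ℚ _ ≤ _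
    rw [adjoin_le_iff]
    rintro _ ⟨k, rfl⟩
    exact coe_mem_adjoin_of_mem_span w (hr_span k)
  have hc : ((((N : ℝ) * v : ℝ)) : ℂ) = (N : ℂ) * ((v : ℝ) : ℂ) := by push_cast; ring
  have hfedw : LastFed m w := by
    unfold LastFed
    rw [hw_last, hc]
    rcases halg with h | h
    · left
      rw [Complex.exp_nat_mul]
      exact (isAlgebraic_up h hB).pow N
    · right
      rw [mul_assoc, Complex.exp_nat_mul]
      exact (isAlgebraic_up h hB).pow N
  exact (kleinPolar_of_lastFed hS h1 hw hIH hfedw).trans ht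

/-- A tuple with fed last coordinate is fed. -/
theorem isFed_of_lastFed {r : Fin (m + 1) → ℝ} (hr : LinearIndependent ℚ r) (h : LastFed m r) : IsFed (m + 1) r := by
  rcases h with h | h
  · exact isFed_of_isAlgebraic_base_exp_coord r (Fin.last m) (hr.ne_zero _) h
  · exact isFed_of_isAlgebraic_base_exp_coord_mul_I r (Fin.last m) (hr.ne_zero _) h

/-- `FedKleinPolar ⟹ FedSharpStep` (hypothesis weakening). -/
theorem fedSharpStep_of_fedKleinPolar (h : FedKleinPolar) : FedSharpStep :=
  fun m r hr hIH hfed _ => h (m + 1) r hr hIH (isFed_of_lastFed hr hfed)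

/-- `FedKleinPolar ⟹ FedSurplusOneStep` (hypothesis weakening). -/
theorem fedSurplusOneStep_of_fedKleinPolar (h : FedKleinPolar) : FedSurplusOneStep :=
  fun m r hr hIH hfed _ => h (m + 1) r hr hIH (isFed_of_lastFed hr hfed)

/-- EXACTNESS of the round-7 cut: `FedKleinPolar ⟺ FedSharpStep ∧ FedSurplusOneStep`. -/
theorem fedKleinPolar_iff_flag_steps : FedKleinPolar ↔ (FedSharpStep ∧ FedSurplusOneStep) :=
  ⟨fun h => ⟨fedSharpStep_of_fedKleinPolar h, fedSurplusOneStep_of_fedKleinPolar h⟩,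
    fun h => fedKleinPolar_of_flag_steps h.1 h.2⟩

end Gen7

end Summit.Schanuel.Schanuel.Theorems.RootDecomp1BFedFlagCore
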